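import Summits.AtomisticToContinuum.FouriersLaw.Theorems.EmbeddedDrudeMourreAbelThermodynamicLimitOfLowerBound
import Summits.AtomisticToContinuum.FouriersLaw.Theorems.LatticeLandauDampingAbelThermodynamicLimitOfUniformAbelianRegularity
import Summits.AtomisticToContinuum.FouriersLaw.Theses.LatticeLandauDamping
import HarnessLib

/-!
# Line `exchange-and-positivity` — crux `LatticeLandauDamping.AbelThermodynamicLimit` (stmt-AtomisticToContinuum-14013)
# as an ASSEMBLY over two EXISTING items (crux-strategist s1, 2026-08-17; ALTERNATIVE line — the lead's skeleton slot is untouched)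

Write `P = pinnedChain ω₂ lam β γ` (all `> 0`), `T > 0`; open `N`-chain with both Langevin baths at `T`:
`J = Σ_b j_b`, `c_N(t) = ∫ J·(P_t J) dμ_{N,T}`, `F_N(ν) = ∫₀^∞ e^{-νt} c_N`, `(N−1)T²D_N = F_N(0⁺)` ((K), landed).

THE LINE.  Every registered line of this crux and of its `rfl`-twin stmt-12596 (loomis rev 5, fekete, SketchIdeator2 rev 9,
static-squeeze) is open exactly at the frequency-0 exchange (R) plus either the positivity half CLB or the typing seam SI; all the
infrastructure (fixed-frequency matching (M), anchored/summed Kubo (K), the regular pair, Karamata, positive type, the seam lemmas)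
is landed.  This skeleton records that end state FOR THIS DECL, with NO conjectural sign law and NO seam:

* `stub_uniformAbelianRegularity` := (R) = `StaticAbelianSqueeze.UniformAbelianRegularity` BY NAME (item stmt-13416):
  `∀ ε>0 ∃ ν₀ ∀ ν∈(0,ν₀)`, eventually in `N`, `|∫₀^∞ (1 − e^{-νt}) c_N| ≤ εN`.
* `stub_conductanceLowerBound` := CLB = `StaticAbelianSqueeze.ConductanceLowerBound` BY NAME (item stmt-11749): `liminf_N D_N > 0`
  along every steady family.
* `AbelThermodynamicLimit_of : (R) → CLB → LatticeLandauDamping.AbelThermodynamicLimit` — the composition, sorry-free: it IS the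
  landed twin certificate `LoomisCompactHorizonWitness.stub_cruxOfRegularityOfLowerBound` (p127832), which elaborates at this type
  because the two route decls are definitionally equal (`crux_eq_twin`, `rfl`).

RECORD (all sorry-free re-exports of landed theorems, for the lead and the tenure planner):
* `conductanceLowerBound_necessary` — CLB-at-`T` is NECESSARY given any Abelian witness (`stub_lowerBoundOfCrux`);
* `repairedCrux_of_uniformAbelianRegularity` — (R) ALONE proves the crux with a shift-invariant HYPOTHESIS witness
  (`stub_repairedCruxOfUniformAbelianRegularity`): after the planner repair the CLB stub is not needed;
* `uniformAbelianRegularity_necessary` — (R)-at-`T` is NECESSARY for every shift-invariant witness with `Dn → κ`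
  (`regularityEstimate_of_tendsto`).
Hence, modulo the seam, the stub set {(R), CLB} is crux-EQUIVALENT: nothing is shredded, nothing is hidden; the hardest stub is (R),
which is the open problem "uniform-in-`N` low-frequency regularity of the open chain's current noise" (Disproof §4 step (3)).
-/

namespace Summit.AtomisticToContinuum.FouriersLaw.Cruxes.AbelThermodynamicLimit.ExchangeAndPositivity

open Summit.AtomisticToContinuum.FouriersLaw.Theses
open Summit.AtomisticToContinuum.FouriersLaw.Theorems.AbelThermodynamicLimit

/-- The two route decls sharing this crux directory are the same proposition (definitional unfolding). -/
theorem crux_eq_twin : LatticeLandauDamping.AbelThermodynamicLimit = EmbeddedDrudeMourre.AbelThermodynamicLimit := rfl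

/-! ## Registered stubs -/

/-- **Stub (R) — the `ν ↓ 0 ↔ N → ∞` exchange, rate-free Abelian form; VERBATIM the crux `StaticAbelianSqueeze.UniformAbelianRegularity`
(item stmt-AtomisticToContinuum-13416, refuter-vetted, open-problem class).**  For `P` (all `> 0`) and `T > 0`: `∀ ε > 0 ∃ ν₀ > 0
∀ ν ∈ (0, ν₀) ∃ N₀ ∀ N ≥ N₀`, `|∫₀^∞ (1 − e^{-νt}) c_N(t) dt| ≤ εN` — the slow part of the open chain's equilibrium total-current noise
carries `o(N)` weight uniformly.  Upper half = sharp `HasBoundedResponse` (no overshoot), lower half = no extensive DC notch.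
Size: XL / open-problem (BLR 2000 §6.3, §7).  It closes when stmt-13416 closes (`UniformAbelianRegularity_holds`). -/
theorem stub_uniformAbelianRegularity : StaticAbelianSqueeze.UniformAbelianRegularity := by
  sorry

/-- **Stub CLB — no anomalous insulation; VERBATIM the crux `StaticAbelianSqueeze.ConductanceLowerBound`
(item stmt-AtomisticToContinuum-11749, refuter-vetted, shared with JunctionLocality, actively led).**  Under weak-NESS uniqueness, for
every steady family of `P` (all `> 0`), `T > 0` and response coefficients `D_N`: `∃ c > 0, N₁, ∀ N ≥ N₁, c ≤ D_N`.
Size: XL.  NECESSARY for the crux given any Abelian witness (`conductanceLowerBound_necessary`); DROPPABLE after the planner repair of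
the hypothesis witness clause (`repairedCrux_of_uniformAbelianRegularity`).  It closes when stmt-11749 closes. -/
theorem stub_conductanceLowerBound : StaticAbelianSqueeze.ConductanceLowerBound := by
  sorry

/-! ## Composition (kernel-checked, no sorry of its own) -/

/-- **(R) → CLB → the crux BY NAME.**  The landed certificate p127832 read through `crux_eq_twin`: (R) + landed (M) + anchored (K)
give one common limit `L` of `T²·D_N` (every steady family) and of the regular pair's Abel function at `0⁺`; CLB along the canonical
CEHR steady family gives `0 < L`; output witness = the regular pair `(μ*, D*, L/T²)`.  The crux's own γ-blind witness hypothesis is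
idle. [cite: KunduDharNarayan2009, eqs. (8)–(15)] [cite: BonettoLebowitzReyBellet2000, §7 eq. (37)] -/
theorem AbelThermodynamicLimit_of :
    StaticAbelianSqueeze.UniformAbelianRegularity → StaticAbelianSqueeze.ConductanceLowerBound →
      LatticeLandauDamping.AbelThermodynamicLimit :=
  fun hR hCLB => LoomisCompactHorizonWitness.stub_cruxOfRegularityOfLowerBound hR hCLB

/-- The crux from the two registered stubs (open exactly through their `sorryAx`). -/
theorem AbelThermodynamicLimit_of_stubs : LatticeLandauDamping.AbelThermodynamicLimit :=
  AbelThermodynamicLimit_of stub_uniformAbelianRegularity stub_conductanceLowerBound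

/-! ## Record: necessity of each stub, and the repaired crux from (R) alone -/

/-- CLB-at-`T` is NECESSARY: the crux gives, at every `T > 0` carrying an Abelian Green–Kubo witness, `D_N ≥ κ/2 > 0` eventually along
every steady family (landed `stub_lowerBoundOfCrux`, read through `crux_eq_twin`). [folklore] -/
theorem conductanceLowerBound_necessary :
    LatticeLandauDamping.AbelThermodynamicLimit →
      ∀ ω₂ lam β γ : ℝ, 0 < ω₂ → 0 < lam → 0 < β → 0 < γ →
      (∀ (N : ℕ) (T_L T_R : ℝ), 0 < T_L → 0 < T_R →
        ∀ μ ν : MeasureTheory.Measure (Literature.MathematicalPhysics.KineticTheory.HeatConduction.PhaseSpace N),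
          (Literature.MathematicalPhysics.KineticTheory.HeatConduction.pinnedChain ω₂ lam β γ).IsSteadyState N T_L T_R μ →
          (Literature.MathematicalPhysics.KineticTheory.HeatConduction.pinnedChain ω₂ lam β γ).IsSteadyState N T_L T_R ν → μ = ν) →
      ∀ T : ℝ, 0 < T →
        (∃ (μT : MeasureTheory.Measure Literature.MathematicalPhysics.KineticTheory.HeatConduction.ChainConfig)
            (D : Literature.MathematicalPhysics.KineticTheory.HeatConduction.InfiniteChainDynamics
              (Literature.MathematicalPhysics.KineticTheory.HeatConduction.pinnedChain ω₂ lam β γ)) (κ : ℝ),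
          (Literature.MathematicalPhysics.KineticTheory.HeatConduction.pinnedChain ω₂ lam β γ).IsChainGibbsMeasure T μT ∧
          D.PreservesMeasure μT ∧ (∀ t : ℝ, D.HasAbsConvergentCorrelation μT t) ∧ 0 < κ ∧
          Filter.Tendsto (fun ν : ℝ => (T ^ 2)⁻¹ *
            MeasureTheory.integral (MeasureTheory.volume.restrict (Set.Ioi (0:ℝ)))
              (fun t : ℝ => Real.exp (-(ν * t)) * D.currentCorrelation μT t))
            (nhdsWithin (0:ℝ) (Set.Ioi 0)) (nhds κ)) →
        ∀ μ : (N : ℕ) → ℝ → ℝ → MeasureTheory.Measure (Literature.MathematicalPhysics.KineticTheory.HeatConduction.PhaseSpace N),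
          (∀ (N : ℕ) (T_L T_R : ℝ), 0 < T_L → 0 < T_R →
            (Literature.MathematicalPhysics.KineticTheory.HeatConduction.pinnedChain ω₂ lam β γ).IsSteadyState N T_L T_R (μ N T_L T_R)) →
          ∀ Dn : ℕ → ℝ,
            (∀ N : ℕ, Filter.Tendsto (fun δ : ℝ =>
                (Literature.MathematicalPhysics.KineticTheory.HeatConduction.pinnedChain ω₂ lam β γ).totalCurrent
                  (μ N (T + δ / 2) (T - δ / 2)) / δ)
              (nhdsWithin 0 {(0 : ℝ)}ᶜ) (nhds (Dn N))) →
            ∃ c : ℝ, 0 < c ∧ ∃ N₁ : ℕ, ∀ N : ℕ, N₁ ≤ N → c ≤ Dn N :=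
  fun h => LoomisCompactHorizonWitness.stub_lowerBoundOfCrux h

/-- (R) ALONE proves the planner-REPAIRED crux (hypothesis witness clause with `IsShiftInvariant μT`; conclusion verbatim): the landed
`stub_repairedCruxOfUniformAbelianRegularity` of the lead's line, re-exported. After that repair `stub_conductanceLowerBound` is idle. -/
alias repairedCrux_of_uniformAbelianRegularity :=
  SeriesLawAtEveryLaplaceFrequency.stub_repairedCruxOfUniformAbelianRegularity

/-- (R)-at-`T` is NECESSARY for every shift-invariant witness with `Dn → κ` (landed `regularityEstimate_of_tendsto`, re-exported):
given Abelian witnesses, the repaired crux and (R) are EQUIVALENT — the stub is not a strengthening in disguise. -/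
alias uniformAbelianRegularity_necessary :=
  SeriesLawAtEveryLaplaceFrequency.regularityEstimate_of_tendsto

end Summit.AtomisticToContinuum.FouriersLaw.Cruxes.AbelThermodynamicLimit.ExchangeAndPositivity
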